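import Literature.NumberTheory.EllipticCurves.QuadraticTwistSelmerPInfty
import Literature.NumberTheory.EllipticCurves.SubgroupSelmer
import Literature.NumberTheory.EllipticCurves.H1CorestrictionIndexTwo
import HarnessLib

/-!
# Selmer groups over arbitrary Galois extensions are invariant under a change of Weierstrass model — kernel brick 2c of the transport [C] (cell `b2b-bsdres`, seat additive-p1, gen 8)

HONEST FRAMING (cell `b2b-bsdres`, run/shared/lean/b2b/bsd-rank1-residual/, verbatim in every
file): the goal of the cell is to DELETE the COMBINATION-SHAPED residual classes of the
Birch–Swinnerton-Dyer formula for ALL analytic-rank `≤ 1` elliptic curves over `ℚ` — "full BSD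
formula for every rank `≤ 1` curve in class `C`" assembled STRICTLY from published theorems — so
that the rank-`≤ 1` remainder becomes exactly the CONSTRUCTION-SHAPED classes, which are TYPED
(missing-input `Prop`s), NOT attempted. This is not "finishing BSD". The additive sub-cell (seats
additive-p1…p4) is a RESEARCH ROUTE on the construction-shaped classes X3/X4; sub-cell additive-p1
= the potentially MULTIPLICATIVE additive prime (X3♯(M) / X4(M)); no claim beyond the stated
classes; the labels of X3/X4 are UNCHANGED by this file; nothing is booked.

Definitions = concrete additive isomorphisms (no predicate, no named fact) and theorems. Context:
design HOME/b2b-bsdres-additive-p1/KERNEL-C-P3.md. The consumers of the typed input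
`ChiBranchLeadingTerm[Odd]At W p` see the additive curve `W` only up to a change of variables over
`ℚ`: `∃ C, C • V.quadraticTwist (p*) = W`. The tree proves that `ℚ`-isomorphic equations have
corresponding `p^∞`-Selmer groups over the BASE field (`mem_selmerGroupPInfty_iff_h1PrimaryIso_mem`,
file `QuadraticTwistSelmerPInfty`, Silverman X.§4); this file proves the same for the Selmer groups
over an ARBITRARY Galois extension `L = K̄^H` in the subgroup model
(`WeierstrassCurve.selmerGroupOver W p H`, file `SubgroupSelmer`) — in particular over `K_∞`
(`selmerInfty`), which is what the transport [C] needs to pass from `W` to the literal twist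
`V.quadraticTwist (p*)`:

* `modelSubgroupH1Equiv hV H : H¹(H, E₁[p^∞]) ≃+ H¹(H, E₂[p^∞])` for `V • W₁ = W₂` (the tree's
  `h1Equiv` of the `Γ_K`-equivariant `primaryIso`), commuting with EVERY conjugation `σ_*`
  (`modelSubgroupH1Equiv_conjH1`);
* `mem_localKerOver_iff_model` — the local Selmer condition at every `K`-field corresponds (the
  tree's `mem_resKer_iff_h1Equiv_mem` with the `Γ_E`-equivariant `twistLocalIso` and the square
  `pointsMap_twistPointsIso`);
* `mem_selmerGroupOver_iff_model`, `modelSelmerEquiv` — **`Sel_{p^∞}(E₁/L) ≃+ Sel_{p^∞}(E₂/L)`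
  for every normal `H ≤ Γ_K`**.

References: J. H. Silverman, *AEC* (2009), III.3.1(b), X.§4 [SilvermanAEC2009]; R. Greenberg,
LNM 1716 (1999), §2 [GreenbergLNM1716].
-/

noncomputable section

open scoped Classical

universe u

namespace Summit.BirchSwinnertonDyer.Rank1Residual.AdditivePotMult

open Literature.NumberTheory.EllipticCurves Literature.NumberTheory.GaloisRepresentations
  WeierstrassCurve

variable {K : Type u} [Field K] {W₁ W₂ : WeierstrassCurve K} {V : VariableChange K}
  (p : ℕ) (hV : V • W₁ = W₂) (H : Subgroup (Field.absoluteGaloisGroup K))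

/-- `primaryIso` is `H`-equivariant for every `H ≤ Γ_K`. [folklore] -/
theorem primaryIso_smul_subgroup (h : H) (m : geomPrimaryTorsion W₁ p) :
    primaryIso p hV (h • m) = h • primaryIso p hV m :=
  primaryIso_smul p hV (h : Field.absoluteGaloisGroup K) m

/-- **`H¹(L, E₁[p^∞]) ≃+ H¹(L, E₂[p^∞])` for `V • W₁ = W₂` and every `L = K̄^H`** (subgroup model;
the tree's `h1Equiv` of `primaryIso`). Silverman, *AEC*, X.§4. [cite: SilvermanAEC2009, X.§4] -/
def modelSubgroupH1Equiv : W₁.subgroupH1 p H ≃+ W₂.subgroupH1 p H :=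
  h1Equiv (G := H) (primaryIso p hV) (primaryIso_smul_subgroup p hV H)

/-- `modelSubgroupH1Equiv` commutes with every conjugation `σ_*`, `σ ∈ Γ_K` (`H` normal): the
change of variables is defined over `K`. [folklore] -/
theorem modelSubgroupH1Equiv_conjH1 [H.Normal] (σ : Field.absoluteGaloisGroup K)
    (s : W₁.subgroupH1 p H) :
    modelSubgroupH1Equiv p hV H (W₁.conjH1 p H σ s) =
      W₂.conjH1 p H σ (modelSubgroupH1Equiv p hV H s) := by
  obtain ⟨f, rfl⟩ := oneCocycleClass_surjective _ s
  change h1Equiv _ _ (conjH1 H _ σ _) = conjH1 H _ σ (h1Equiv _ _ _)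
  rw [conjH1_oneCocycleClass, h1Equiv_apply, h1Equiv_apply, resH1Hom_id_oneCocycleClass,
    resH1Hom_id_oneCocycleClass, conjH1_oneCocycleClass]
  congr 1
  apply Subtype.ext
  ext n : 1
  rw [contOneCocycles.push_apply, conjCocycle_apply]
  change primaryIso p hV (σ • f.1 (subgroupConj H σ n)) =
    (conjCocycle H σ (contOneCocycles.push
      (primaryIso p hV : geomPrimaryTorsion W₁ p →+ geomPrimaryTorsion W₂ p)
      (primaryIso_smul_subgroup p hV H) f)).1 n
  rw [conjCocycle_apply, contOneCocycles.push_apply]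
  exact primaryIso_smul p hV σ _

/-- **The local Selmer condition at every `K`-field `E` corresponds under the change of model**
(kernels of `H¹(H, Eᵢ[p^∞]) → H¹(H_E, Eᵢ(K̄_E))`; the tree's `mem_resKer_iff_h1Equiv_mem` for the
square `pointsMap ∘ primaryIso = twistLocalIso ∘ pointsMap`, `twistLocalIso` being
`Γ_E`-equivariant). Silverman, *AEC*, X.§4; Greenberg (1999), §2. [cite: GreenbergLNM1716, §2] -/
theorem mem_localKerOver_iff_model (E : Type u) [Field E] [Algebra K E] (s : W₁.subgroupH1 p H) :
    s ∈ W₁.localKerOver p H E ↔ modelSubgroupH1Equiv p hV H s ∈ W₂.localKerOver p H E := by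
  change s ∈ resKer _ _ _ ↔ h1Equiv _ _ s ∈ resKer _ _ _
  exact mem_resKer_iff_h1Equiv_mem (resGalSubgroup H E)
    ((pointsMap W₁ E).comp (W₁.geomPrimaryTorsion p).subtype) _
    ((pointsMap W₂ E).comp (W₂.geomPrimaryTorsion p).subtype) _
    (primaryIso p hV) (primaryIso_smul_subgroup p hV H)
    (twistLocalIso E hV) (fun τ Q ↦ twistLocalIso_smul E hV (τ : Field.absoluteGaloisGroup E) Q)
    (fun m ↦ pointsMap_twistPointsIso E hV (m : geomPoints W₁)) s

variable [NumberField K] [H.Normal]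

/-- **`Sel_{p^∞}(E₁/L)` and `Sel_{p^∞}(E₂/L)` correspond for `V • W₁ = W₂`, every normal
`H ≤ Γ_K`** (`L = K̄^H`; all places of `K`, all conjugates). Silverman, *AEC*, X.§4 (Selmer groups
are attached to `E/K`, not to an equation). [cite: SilvermanAEC2009, X.§4] -/
theorem mem_selmerGroupOver_iff_model (s : W₁.subgroupH1 p H) :
    s ∈ W₁.selmerGroupOver p H ↔ modelSubgroupH1Equiv p hV H s ∈ W₂.selmerGroupOver p H := by
  rw [mem_selmerGroupOver_iff, mem_selmerGroupOver_iff]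
  have key : ∀ (σ : Field.absoluteGaloisGroup K) (E : Type u) [Field E] [Algebra K E],
      W₁.conjH1 p H σ s ∈ W₁.localKerOver p H E ↔
        W₂.conjH1 p H σ (modelSubgroupH1Equiv p hV H s) ∈ W₂.localKerOver p H E := by
    intro σ E _ _
    rw [mem_localKerOver_iff_model p hV H E, modelSubgroupH1Equiv_conjH1]
  exact ⟨fun h ↦ ⟨fun v σ ↦ (key σ _).mp (h.1 v σ), fun w σ ↦ (key σ _).mp (h.2 w σ)⟩,
    fun h ↦ ⟨fun v σ ↦ (key σ _).mpr (h.1 v σ), fun w σ ↦ (key σ _).mpr (h.2 w σ)⟩⟩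

/-- **The isomorphism `Sel_{p^∞}(E₁/L) ≃+ Sel_{p^∞}(E₂/L)`** for `V • W₁ = W₂`, `L = K̄^H`.
[cite: SilvermanAEC2009, X.§4] -/
def modelSelmerEquiv : W₁.selmerGroupOver p H ≃+ W₂.selmerGroupOver p H where
  toFun s := ⟨modelSubgroupH1Equiv p hV H s, (mem_selmerGroupOver_iff_model p hV H s).mp s.2⟩
  invFun s := ⟨(modelSubgroupH1Equiv p hV H).symm s, by
    have h := (mem_selmerGroupOver_iff_model p hV H ((modelSubgroupH1Equiv p hV H).symm s)).mpr
    rw [AddEquiv.apply_symm_apply] at h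
    exact h s.2⟩
  left_inv s := Subtype.ext ((modelSubgroupH1Equiv p hV H).symm_apply_apply _)
  right_inv s := Subtype.ext ((modelSubgroupH1Equiv p hV H).apply_symm_apply _)
  map_add' s s' := Subtype.ext (map_add _ _ _)

/-- Values of `modelSelmerEquiv`. [folklore] -/
theorem coe_modelSelmerEquiv (s : W₁.selmerGroupOver p H) :
    ((modelSelmerEquiv p hV H s : W₂.selmerGroupOver p H) : W₂.subgroupH1 p H) =
      modelSubgroupH1Equiv p hV H s :=
  rfl

/-- `modelSelmerEquiv` commutes with every conjugation `σ_*` (on underlying classes). [folklore] -/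
theorem coe_modelSelmerEquiv_conjH1 (σ : Field.absoluteGaloisGroup K) (s : W₁.selmerGroupOver p H) :
    modelSubgroupH1Equiv p hV H (W₁.conjH1 p H σ s) =
      W₂.conjH1 p H σ (modelSelmerEquiv p hV H s : W₂.selmerGroupOver p H) :=
  modelSubgroupH1Equiv_conjH1 p hV H σ s

end Summit.BirchSwinnertonDyer.Rank1Residual.AdditivePotMult

end
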